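import Summits.CriticalPhenomena.SAWScalingLimit.Theses.SAWTipEnvironment
import Literature.Probability.RandomPlanarGeometry.SLELawOfDrivingProcessLocal
import Literature.Probability.RandomPlanarGeometry.DrivingFunctionMeasurable
import Literature.Probability.RandomPlanarGeometry.LoewnerDescription
import Literature.Probability.Process.LocalMartingaleFromObservables
import Literature.Probability.Process.NaturalFiltrationMartingale
import Literature.Probability.Process.ContinuousHitting

/-!
# Birth skeleton for crux `DrivingIdentification` (stmt-CriticalPhenomena-16041), route `SAWTipEnvironment`

Crux (route `Summits/CriticalPhenomena/SAWScalingLimit/Theses/SAWTipEnvironment.lean`, rank 9, "pure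
stochastic calculus, provable now from the tree"):

  `DrivingIdentification := ∀ κ ∈ (0,4), D, φ chordal uniformizing, ν probability law on curve classes,
   ν-a.e. Loewner-describable from a, the cylinder (monotone-class) martingale identities for the STOPPED
   Loewner transform W^{τ_m}, (W² − κ·)^{τ_m} (W = drivingFunction φ, τ_m = inf{t : |W_t| ≥ m} ∧ m, all m)
   ⟹ IsSLELaw κ D ν`.

## The line (CDHKS 2014 §3, last paragraph; grounder notes g51-4/g51-6 on the item)

* `stub_naturalMartingales : NaturalMartingalesOfCylinder` — MONOTONE CLASS AT A FIXED LEVEL, on any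
  probability space: for a real process `W` with strongly measurable coordinates, continuous paths and
  `W_0 = 0` a.s., a stopping time `σ` of the natural filtration of `W` dominated by the exit time of `W`
  from `(−m, m)` (`m ≥ 1`), the cylinder identities `E[(X_t − X_s) ψ(W_{S_0},…,W_{S_{n−1}})] = 0` for
  `X = W^σ` and `X = (W^σ)² − κ(· ∧ σ)` imply that both are martingales in the natural filtration
  (tree engine `Process.martingale_natural_of_integral_cylinder`; content to supply: strong adaptedness of
  the stopped process — progressive measurability — and integrability from the a.e. bound `|W^σ| ≤ m`).
* `stub_levyFormat : LevyFormatOfStoppedMartingales` — LOCALISATION: if for every level `m ≥ 1` the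
  processes `W^{σ_m}`, `(W^{σ_m})² − κ(· ∧ σ_m)` are `𝓕`-martingales, `σ_m` = exit time from `(−m, m)`
  capped at `m`, then `W/√κ` is a continuous local martingale with `⟨W/√κ⟩_t = t` (`IsLocalMartingale`,
  `Process.HasQuadraticVariation`): the capped exit times are a localizing sequence (stopping times,
  monotone, `→ ⊤` by continuity), `⊥ < σ_m` a.s. from `W_0 = 0` (the indicator of Mathlib's `Locally`),
  scaling by `(√κ)⁻¹` / `κ⁻¹` (model: `Process.isLocalMartingale_hasQuadraticVariation_of_approx`, second
  half, which localises at UNCAPPED exit times).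
* sorry-free glue proved here: the dictionary `τ_m = σ_m` between the crux's inline hitting level
  `sInf ({t | m ≤ |W_t|} ∪ {m})` and the tree's `Process.exitTime` (`coe_sInf_union_eq_min_exitTime`),
  the transfer of the crux's cylinder identities to the stopped-process vocabulary
  (`levyFormat_of_cylinderIdentities`), and the composition `DrivingIdentification_of`:
  `W := drivingFunction φ` has strongly measurable marginals (`stronglyMeasurable_drivingFunction_apply`),
  continuous paths for EVERY class (`continuous_drivingFunction`, junk `0`), `W_0 = 0` a.s. from
  `source = a` (`ae_drivingFunction_apply_zero`), is a.s. a driving function of the class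
  (`isLoewnerDescribed_drivingFunction`), and the tree's PROVED
  `isSLELaw_of_isLocalMartingale_driving_of_lt_four` (Lévy + Rohde–Schramm trace/transience for κ < 4,
  all theorems) concludes the crux BY NAME.

## Disproof / negatives used
* `Cruxes/DrivingIdentification/Disproof.lean`: none exists for this item (`ledger crux ls
  stmt-CriticalPhenomena-16041`, 2026-08-17: only the `Lines/birth.*` of the homonymous crux of route
  `SAWExcursionCardy`, stmt-5126, which this file does not touch) — no `_false_without_` obstruction.
* `ledger negatives --problem CriticalPhenomena`: no entry concerns driving processes / Lévy
  identification; no stub asserts tightness or a lattice observable value.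
* Vacuity: the crux's `τ_m` is `NNReal`-valued and capped, `drivingFunction φ c` is continuous for every
  `c`, so `τ_m` is a genuine (capped) hitting time of a closed set and the stopped integrands are a.e.
  bounded by `m`, `m² + κ m` — the Bochner integrals in the hypothesis are not junk (this is exactly what
  `stub_naturalMartingales` certifies); `m = 0` gives `τ_0 = 0` and trivial identities, unused (levels
  `m ≥ 1` suffice for localisation).
-/

noncomputable section

open MeasureTheory Filter Topology Set ProbabilityTheory
open scoped NNReal ENNReal
open Literature.Probability.RandomPlanarGeometry Literature.Probability.Process

namespace Summit.CriticalPhenomena.SAWScalingLimit.Cruxes.DrivingIdentification.TipEnvBirth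

/-! ### 1. The stub statements -/

/-- **Stub A — natural martingales from the cylinder identities at a fixed level.** On a probability
space, let `W : ℝ≥0 → Ω → ℝ` have strongly measurable coordinates, continuous paths and `W_0 = 0`
a.s.; let `m ≥ 1` and let `σ` be a stopping time of the natural filtration of `W` with
`σ ≤ exitTime W (−m) m` (so `|W^σ| ≤ m` a.s.). If the stopped process `X¹ = W^σ` and
`X² = (W^σ)² − κ (· ∧ σ)` satisfy the cylinder identities against bounded continuous functions of
finitely many earlier coordinates of `W`, then both are martingales in the natural filtration of `W`.
(Monotone class: `Process.martingale_natural_of_integral_cylinder`; plus progressive measurability of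
the stopped process and integrability from the a.e. bound.) -/
def NaturalMartingalesOfCylinder : Prop :=
  ∀ {Ω : Type} [MeasurableSpace Ω] (P : Measure Ω) [IsProbabilityMeasure P] (W : ℝ≥0 → Ω → ℝ)
    (hW : ∀ t, StronglyMeasurable (W t)), (∀ ω, Continuous (W · ω)) → (∀ᵐ ω ∂P, W 0 ω = 0) →
    ∀ (κ : ℝ) (m : ℕ), 0 < m → ∀ σ : Ω → WithTop ℝ≥0,
      IsStoppingTime (Filtration.natural W hW) σ →
      (∀ ω, σ ω ≤ exitTime W (-(m : ℝ)) m ω) →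
      (∀ s t : ℝ≥0, s ≤ t → ∀ (n : ℕ) (S : Fin n → ℝ≥0), (∀ k, S k ≤ s) →
        ∀ ψ : (Fin n → ℝ) → ℝ, Continuous ψ → (∀ v, |ψ v| ≤ 1) →
          (∫ ω, (stoppedProcess W σ t ω - stoppedProcess W σ s ω) * ψ (fun k ↦ W (S k) ω) ∂P = 0) ∧
          (∫ ω, (stoppedProcess W σ t ω ^ 2 - κ * (((min (t : WithTop ℝ≥0) (σ ω)).untopA : ℝ≥0) : ℝ) -
              (stoppedProcess W σ s ω ^ 2 - κ * (((min (s : WithTop ℝ≥0) (σ ω)).untopA : ℝ≥0) : ℝ))) *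
            ψ (fun k ↦ W (S k) ω) ∂P = 0)) →
      Martingale (stoppedProcess W σ) (Filtration.natural W hW) P ∧
      Martingale (fun t ω ↦ stoppedProcess W σ t ω ^ 2 -
          κ * (((min (t : WithTop ℝ≥0) (σ ω)).untopA : ℝ≥0) : ℝ)) (Filtration.natural W hW) P

/-- **Stub B — Lévy's format from the stopped martingales at all levels (localisation).** On a
probability space with a filtration `𝓕`, let `W` be `𝓕`-adapted with continuous paths and `W_0 = 0`
a.s., `κ > 0`. If for every level `m ≥ 1`, with `σ_m := exitTime W (−m) m ∧ m`, the processes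
`W^{σ_m}` and `(W^{σ_m})² − κ (· ∧ σ_m)` are `𝓕`-martingales, then `W/√κ` is a continuous local
martingale with quadratic variation `t` (`IsLocalMartingale` = Mathlib `Locally`,
`Process.HasQuadraticVariation`) — the hypothesis format of
`isSLELaw_of_isLocalMartingale_driving_of_lt_four`. (The capped exit times form a localizing sequence;
`⊥ < σ_m` a.s.; scaling.) -/
def LevyFormatOfStoppedMartingales : Prop :=
  ∀ {Ω : Type} [MeasurableSpace Ω] (P : Measure Ω) [IsProbabilityMeasure P]
    (𝓕 : Filtration ℝ≥0 ‹MeasurableSpace Ω›) (W : ℝ≥0 → Ω → ℝ),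
    Adapted 𝓕 W → (∀ ω, Continuous (W · ω)) → (∀ᵐ ω ∂P, W 0 ω = 0) →
    ∀ κ : ℝ≥0, 0 < κ →
      (∀ m : ℕ, 0 < m →
        let σ : Ω → WithTop ℝ≥0 := fun ω ↦ min (exitTime W (-(m : ℝ)) m ω) ((m : ℝ≥0) : WithTop ℝ≥0)
        Martingale (stoppedProcess W σ) 𝓕 P ∧
        Martingale (fun t ω ↦ stoppedProcess W σ t ω ^ 2 -
          (κ : ℝ) * (((min (t : WithTop ℝ≥0) (σ ω)).untopA : ℝ≥0) : ℝ)) 𝓕 P) →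
      IsLocalMartingale (fun t ω ↦ (Real.sqrt κ)⁻¹ * W t ω) 𝓕 P ∧
      HasQuadraticVariation (fun t ω ↦ (Real.sqrt κ)⁻¹ * W t ω) (fun t _ ↦ (t : ℝ)) 𝓕 P

/-! ### 2. The registered stubs (the only `sorry`s of this file) -/

/-- Stub A (size M): monotone class at a fixed level, see `NaturalMartingalesOfCylinder`. -/
theorem stub_naturalMartingales : NaturalMartingalesOfCylinder := by
  sorry

/-- Stub B (size M): localisation at the capped exit times, see `LevyFormatOfStoppedMartingales`. -/
theorem stub_levyFormat : LevyFormatOfStoppedMartingales := by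
  sorry

/-! Name-keyed aliases of the stub statements (hypotheses of the composition): the skeleton audit
admits a `Prop` hypothesis of `DrivingIdentification_of` iff its head constant carries a registered
stub's short name (device of `Cruxes/ChainLaw/Lines/birth.lean`). -/
namespace Registered

/-- Alias keyed by the registered stub name. -/
abbrev stub_naturalMartingales : Prop := NaturalMartingalesOfCylinder
/-- Alias keyed by the registered stub name. -/
abbrev stub_levyFormat : Prop := LevyFormatOfStoppedMartingales

end Registered

/-! ### 3. Sorry-free glue: the crux's hitting level is the tree's capped exit time -/

/-- **Dictionary.** The crux's inline level `τ_m = sInf ({t | m ≤ |W_t|} ∪ {m}) : ℝ≥0` is the exit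
time of `W` from `(−m, m)` (`Process.exitTime`, valued in `WithTop ℝ≥0`) capped at `m` — for every
path, with no continuity needed (both sides are the same infimum). -/
theorem coe_sInf_union_eq_min_exitTime {Ω : Type*} (W : ℝ≥0 → Ω → ℝ) (ω : Ω) (m : ℕ) :
    (((sInf ({t : ℝ≥0 | (m : ℝ) ≤ |W t ω|} ∪ {(m : ℝ≥0)})) : ℝ≥0) : WithTop ℝ≥0) =
      min (exitTime W (-(m : ℝ)) m ω) ((m : ℝ≥0) : WithTop ℝ≥0) := by
  classical
  have hset : {j : ℝ≥0 | W j ω ∈ (Set.Ioo (-(m : ℝ)) m)ᶜ} = {t : ℝ≥0 | (m : ℝ) ≤ |W t ω|} := by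
    ext j
    simp only [Set.mem_setOf_eq, Set.mem_compl_iff, Set.mem_Ioo, not_and_or, not_lt]
    rw [le_abs']
  by_cases hex : ∃ j, W j ω ∈ (Set.Ioo (-(m : ℝ)) m)ᶜ
  · have hne : ({t : ℝ≥0 | (m : ℝ) ≤ |W t ω|}).Nonempty := by
      obtain ⟨j, hj⟩ := hex
      exact ⟨j, by rw [← hset]; exact hj⟩
    rw [exitTime_def, hittingAfter_zero_apply_of_exists hex, hset, ← WithTop.coe_min]
    congr 1
    rw [csInf_union (OrderBot.bddBelow _) hne (OrderBot.bddBelow _) (Set.singleton_nonempty _),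
      csInf_singleton]
  · have hall : ∀ j, W j ω ∉ (Set.Ioo (-(m : ℝ)) m)ᶜ := not_exists.1 hex
    have hemp : {t : ℝ≥0 | (m : ℝ) ≤ |W t ω|} = ∅ := by
      rw [← hset, Set.eq_empty_iff_forall_notMem]
      exact hall
    rw [exitTime_def, hittingAfter_zero_apply_of_forall hall, min_eq_right le_top, hemp,
      Set.empty_union, csInf_singleton]

/-- The stopped process at the capped exit time, read through the dictionary. -/
theorem stoppedProcess_cappedExit_eq {Ω : Type*} (W : ℝ≥0 → Ω → ℝ) (m : ℕ) (r : ℝ≥0) (ω : Ω) :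
    stoppedProcess W (fun ω ↦ min (exitTime W (-(m : ℝ)) m ω) ((m : ℝ≥0) : WithTop ℝ≥0)) r ω =
      W (min r (sInf ({t : ℝ≥0 | (m : ℝ) ≤ |W t ω|} ∪ {(m : ℝ≥0)}))) ω := by
  simp only [stoppedProcess]
  rw [← coe_sInf_union_eq_min_exitTime W ω m, untopA_min_coe_coe]

/-- The stopped clock at the capped exit time, read through the dictionary. -/
theorem clock_cappedExit_eq {Ω : Type*} (W : ℝ≥0 → Ω → ℝ) (m : ℕ) (r : ℝ≥0) (ω : Ω) :
    (((min (r : WithTop ℝ≥0) (min (exitTime W (-(m : ℝ)) m ω) ((m : ℝ≥0) : WithTop ℝ≥0))).untopA :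
        ℝ≥0) : ℝ) = ((min r (sInf ({t : ℝ≥0 | (m : ℝ) ≤ |W t ω|} ∪ {(m : ℝ≥0)})) : ℝ≥0) : ℝ) := by
  rw [← coe_sInf_union_eq_min_exitTime W ω m, untopA_min_coe_coe]

/-- **From the crux's cylinder identities to Lévy's format** (sorry-free given the two stubs): for a
real process `W` with strongly measurable coordinates, continuous paths, `W_0 = 0` a.s. and `κ > 0`,
the cylinder identities of the crux (levels `τ_m` in the crux's inline `sInf` form) give, in the natural
filtration of `W`, that `W/√κ` is a continuous local martingale with quadratic variation `t`. -/
theorem levyFormat_of_cylinderIdentities (hA : Registered.stub_naturalMartingales)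
    (hB : Registered.stub_levyFormat) {Ω : Type} [MeasurableSpace Ω] (P : Measure Ω)
    [IsProbabilityMeasure P] (W : ℝ≥0 → Ω → ℝ) (hW : ∀ t, StronglyMeasurable (W t))
    (hWc : ∀ ω, Continuous (W · ω)) (hW0 : ∀ᵐ ω ∂P, W 0 ω = 0) {κ : ℝ≥0} (hκ : 0 < κ)
    (hcyl : ∀ (m : ℕ) (s t : ℝ≥0), s ≤ t → ∀ (n : ℕ) (S : Fin n → ℝ≥0), (∀ k, S k ≤ s) →
      ∀ ψ : (Fin n → ℝ) → ℝ, Continuous ψ → (∀ v, |ψ v| ≤ 1) →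
        (∫ ω, (W (min t (sInf ({r : ℝ≥0 | (m : ℝ) ≤ |W r ω|} ∪ {(m : ℝ≥0)}))) ω -
            W (min s (sInf ({r : ℝ≥0 | (m : ℝ) ≤ |W r ω|} ∪ {(m : ℝ≥0)}))) ω) *
          ψ (fun k ↦ W (S k) ω) ∂P = 0) ∧
        (∫ ω, ((W (min t (sInf ({r : ℝ≥0 | (m : ℝ) ≤ |W r ω|} ∪ {(m : ℝ≥0)}))) ω) ^ 2 -
            (κ : ℝ) * ((min t (sInf ({r : ℝ≥0 | (m : ℝ) ≤ |W r ω|} ∪ {(m : ℝ≥0)})) : ℝ≥0) : ℝ) -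
            ((W (min s (sInf ({r : ℝ≥0 | (m : ℝ) ≤ |W r ω|} ∪ {(m : ℝ≥0)}))) ω) ^ 2 -
              (κ : ℝ) * ((min s (sInf ({r : ℝ≥0 | (m : ℝ) ≤ |W r ω|} ∪ {(m : ℝ≥0)})) : ℝ≥0) : ℝ))) *
          ψ (fun k ↦ W (S k) ω) ∂P = 0)) :
    IsLocalMartingale (fun t ω ↦ (Real.sqrt κ)⁻¹ * W t ω) (Filtration.natural W hW) P ∧
      HasQuadraticVariation (fun t ω ↦ (Real.sqrt κ)⁻¹ * W t ω) (fun t _ ↦ (t : ℝ))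
        (Filtration.natural W hW) P := by
  have hWad : Adapted (Filtration.natural W hW) W := (Filtration.stronglyAdapted_natural hW).adapted
  refine hB P (Filtration.natural W hW) W hWad hWc hW0 κ hκ fun m hm ↦ ?_
  dsimp only
  have hσ : IsStoppingTime (Filtration.natural W hW)
      (fun ω ↦ min (exitTime W (-(m : ℝ)) m ω) ((m : ℝ≥0) : WithTop ℝ≥0)) :=
    (isStoppingTime_exitTime hWad hWc).min_const (m : ℝ≥0)
  refine hA P W hW hWc hW0 (κ : ℝ) m hm _ hσ (fun ω ↦ min_le_left _ _) ?_
  intro s t hst n S hS ψ hψ hψb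
  have key := hcyl m s t hst n S hS ψ hψ hψb
  simp only [stoppedProcess_cappedExit_eq, clock_cappedExit_eq]
  exact key

/-! ### 4. The composition (kernel-checked, no `sorry`) -/

/-- **The two stubs imply the crux `DrivingIdentification` BY NAME.** With `W := drivingFunction φ`
(strongly measurable marginals, continuous paths for every class, `W_0 = 0` a.s. from `source = a`),
the crux's cylinder identities give Lévy's format in the natural filtration
(`levyFormat_of_cylinderIdentities` = stub A at every level + stub B), `ν`-a.e. class is driven by
`W c` (`isLoewnerDescribed_drivingFunction`), and the tree's PROVED
`isSLELaw_of_isLocalMartingale_driving_of_lt_four` (`0 < κ < 4`: Lévy's characterisation, existence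
and transience of the SLE_κ trace are theorems) identifies `ν` as the chordal SLE_κ law. -/
theorem DrivingIdentification_of (hA : Registered.stub_naturalMartingales)
    (hB : Registered.stub_levyFormat) :
    Summit.CriticalPhenomena.SAWScalingLimit.Theses.SAWTipEnvironment.DrivingIdentification := by
  intro κ D φ ν hκ hκ4 hφ hν hdesc hcyl
  haveI := hν
  have hW : ∀ t, StronglyMeasurable (fun c : CurveClass ℂ ↦ drivingFunction φ c t) := fun t ↦
    stronglyMeasurable_drivingFunction_apply hφ t
  have hWc : ∀ c : CurveClass ℂ, Continuous (fun t ↦ drivingFunction φ c t) := fun c ↦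
    continuous_drivingFunction φ c
  have hW0 : ∀ᵐ c ∂ν, drivingFunction φ c 0 = 0 :=
    ae_drivingFunction_apply_zero hφ (hdesc.mono fun c hc ↦ hc.2)
  obtain ⟨hM, hQ⟩ := levyFormat_of_cylinderIdentities hA hB ν
    (fun t (c : CurveClass ℂ) ↦ drivingFunction φ c t) hW hWc hW0 hκ hcyl
  refine isSLELaw_of_isLocalMartingale_driving_of_lt_four hκ hκ4 hφ
    (fun t ↦ (hW t).measurable) hW0 (ae_of_all _ hWc) hM hQ ?_
  filter_upwards [hdesc] with c hc
  obtain ⟨-, γ, hγ, c', hc', hI⟩ := isLoewnerDescribed_drivingFunction hc.1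
  exact ⟨γ, hγ, c', hc', hI⟩

end Summit.CriticalPhenomena.SAWScalingLimit.Cruxes.DrivingIdentification.TipEnvBirth

end
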